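/-
Copyright (c) 2026 the pub-hodgecm-mathlib formalisation cell (harness21).  Prover seat hodgecm-mathlib-K2E3-p21 (g3), HCML Track B «K2-LIT» (build stream 29),
h413 = `stmt-HodgeConjecture-24833`, line `K2_E3_EllipticInputs`, unit U12 «Characters», socket #11 road (11-SC), letter (SC-an): HARISH-CHANDRA'S THEOREM 20
«cusp-form cancellation» FOR THE MODEL `U(σ, Φ₃)(K)` = ★ (T20-e1) `cuspForm_cancellation_conjLevel` (K2E3-p14 (g3)) with EVERY group-side hypothesis DISCHARGED
(★ (T20-c), ★ (T20-e2), ★ FILE 1∕2 of this seat); line lead K2E3-p20 (g3).  2026-09-04.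
-/
import Summits.HodgeConjecture.HodgeConjecture.Theorems.K2E3CuspFormCancellationCore       -- ★ (T20-e1) p856650 (K2E3-p14 (g3)): `cuspForm_cancellation_conjLevel` (abstract THEOREM 20 = e2 ∘ e1)
import Summits.HodgeConjecture.HodgeConjecture.Theorems.K2E3CuspFormCancellationU3Inputs   -- ★ (this seat) FILE 2: the group-side hypotheses at `U(σ,Φ₃)(K)`; brings FILE 1, ★ (T20-c)
import Literature.NumberTheory.Automorphic.ReductionTheoryGLnConjugation                    -- ★ `isClosed_upperUnitriangular` (`N` is closed)
import HarnessLib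

/-!
# h413 ∕ Track B «K2-LIT», (SC-an) Theorem-20 line — THEOREM 20 (CUSP-FORM CANCELLATION) FOR THE RANK-ONE MODEL `U(σ, Φ₃)(K)`
# `y ∈ Ω_s`, `x ∉ Ω_{m_C + (m + 2s + 4m_C) + s}` ⟹ `∫_{K_m ∩ y⁻¹ K_m y} f(x y k) dμ(k) = 0` for every continuous cusp form `f` supported in `C·T`, `C ⊆ Ω_{m_C}`
# (Harish-Chandra 1970, Part VII §2 Theorem 20 p. 70; §8 pp. 80–84)

Cell `pub/hodgecm-mathlib`, crux H413 = `stmt-HodgeConjecture-24833`, route of record `HCCMUnconditional`; chair K2-lead (g0), dealer K2E3-plan (g2), line lead K2E3-p20 (g3);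
split (T20-e) = (T20-e1) CORE (K2E3-p14 (g3), ★ p856650) + (T20-e2) HEIGHTS (this seat, ★ p856608).  THEOREMS ONLY (no `def`, no `instance`, no `notation`, no named-fact
hypothesis, no `sorry`); lane `--supports stmt-HodgeConjecture-24833 --as helper`, count-neutral.

WHAT THIS FILE DOES.  ★ `K2E3CuspFormCancellationCore.cuspForm_cancellation_conjLevel` is THEOREM 20 for an abstract group with ≈ 20 structural hypotheses (height balls, Iwahori
orders, `A = A⁺ ∪ A⁻`, contractions, Lemma 54, deep levels, …).  Here `G := U = ↥(unitaryGroupOfForm σ J)`, `J = Φ₃`, over a non-archimedean local field `K` (compatible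
`Valued K ℤᵐ⁰` ∕ `ValuativeRel`), `σ` a continuous isometric ring endomorphism, `ϖ` a uniformiser; `Ω` = any family with the height-ball membership of ★ p856390 (`hmem`, `hinv`,
`hmul` — the three clauses of ★ `exists_heightBall_compactExhaustion`); `K₀ := K_{|ϖ|^m} ∩ U` (`m ≥ 1`), `K′ := K₀ ⊓ y⁻¹K₀y`, `T := torusU`, `N := unipotentU`, `N̄ := w₀ N w₀`,
`A := T`, `A⁺ := {diag d : |d₀| ≥ 1}`, `A⁻ := {diag d : |d₀| ≤ 1}`, `L j := K_{|ϖ|^j} ∩ U`; and EVERY structural hypothesis is discharged BY NAME: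
`hK₀` ★ FILE 2 `coe_level_subset_heightBall_zero` · `hK'y` ★ FILE 2 `mem_inf_map_conj_inv_iff` · `hdeep` ★ (T20-c) `conj_mem_comap_congruenceGL_of_heightBall` +
`comap_congruenceGL_le_inf_map_conj_of_heightBall` · `hK'o`, `hK'c` ★ `isCompact_isOpen_comap_congruenceGL` + conjugation · `hN` ★ `isClosed_upperUnitriangular` · `hNbar` (image under
the homeomorphism `conj w₀`) · `hAcover` ★ FILE 2 `torusU_mem_plus_or_minus` · `hIw`, `hIw'` ★ (T20-c) `exists_iwahori_factorisations_of_mem_comap_congruenceGL` · `hT` ★ FILE 2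
`conj_mem_level_of_mem_torusU` · `hnormN`, `hnormNbar` ★ FILE 2 · `h54N`, `h54Nbar` ★ FILE 2 (Lemma 54) · `hplusV`, `hminusV`, `hplusC`, `hminusC` ★ FILE 2 (the four conjugation
bounds).  What REMAINS as hypotheses is exactly print's datum `f ∈ Φ_C`: `f` continuous, `supp f ⊆ C·T` with `C ⊆ Ω_{m_C}` (★ (T20-b) `K2E3SupercuspOrbitalSliceCuspidal`
supplies it for `f_γ(x) = θ(xγx⁻¹)`), and cuspidality along `N` and `N̄` for left Haar measures `ν`, `ν̄` on them; plus a left Haar measure `μ` on `U`.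
* §1 topology: `isClosed_coe_N`, `isClosed_coe_Nbar`, `isCompact_isOpen_conjLevel` (`K₀ ⊓ y⁻¹K₀y` is compact open).
* §2 **`cuspForm_cancellation_U3`** — THEOREM 20 for `U(σ, Φ₃)(K)` at the conjugate level `K₀(y⁻¹)`.
The CM dress (`(cmDatum L 3 H).Local v ≃ₜ* U(σ_w, Φ₃)(L_w)` at a non-split place, ★ `localNonsplitEquiv`; `Ω` from ★ p856390 §2) and the `K₀(y⁻¹) ↝ K₁` upgrade of p. 71
are (T20-f) ∕ K2E3-p14 (g3)'s sequel.

HONEST LABEL.  HC_CM is proved only modulo the 7 printed citations (2 remaining named inputs: hLiu418 = `stmt-HodgeConjecture-24832`, h413 = `stmt-HodgeConjecture-24833`)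
until rung 0 closes; count-neutral helper (Theorem 20 is an intermediate of (SC-an), not a printed citation of HC_CM).

## References
* [HarishChandra1970] Harish-Chandra (notes by G. van Dijk), *Harmonic Analysis on Reductive p-adic Groups*, LNM 162 (1970), Part VII §2 Theorem 20 p. 70; §8 pp. 80–84.
* [Casselman1995] W. Casselman, *Introduction to the theory of admissible representations of `p`-adic reductive groups* (1995 notes), Prop. 1.4.3–1.4.4.
* [Rogawski1990] J. D. Rogawski, *Automorphic Representations of Unitary Groups in Three Variables*, Ann. of Math. Stud. 123 (1990), §1.10 p. 9; §12.2 p. 173.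
-/

set_option autoImplicit false
set_option linter.dupNamespace false  -- the mandated namespace repeats the single-problem summit's segment (`HodgeConjecture.HodgeConjecture`)

noncomputable section

open scoped MatrixGroups WithZero Pointwise
open MeasureTheory Topology ValuativeRel Matrix
open Literature.NumberTheory.Automorphic Literature.NumberTheory.Automorphic.UnitaryGroup
open Summit.HodgeConjecture.HodgeConjecture.Cruxes.H413.K2E3CuspFormCancellationU3Inputs

namespace Summit.HodgeConjecture.HodgeConjecture.Cruxes.H413.K2E3CuspFormCancellationU3

section Model

variable {K : Type*} [Field K] [Valued K ℤᵐ⁰] [ValuativeRel K] [(Valued.v : Valuation K ℤᵐ⁰).Compatible] [IsNonarchimedeanLocalField K]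
  (σ : K →+* K) (hσc : Continuous σ) (hσv : ∀ x, Valued.v (σ x) = Valued.v x)
  {J : Matrix (Fin 3) (Fin 3) K} (hJ : J = (StdForm.antidiagonal 3).over K)

/-! ## §1 Topology: `N`, `N̄` are closed; `K₀(y⁻¹)` is compact open -/

omit [(Valued.v : Valuation K ℤᵐ⁰).Compatible] in
/-- `N = unipotentU` is closed in `U` (★ `isClosed_upperUnitriangular` pulled back along the closed-subgroup inclusion). [cite: Rogawski1990, §1.10 p. 9] -/
theorem isClosed_coe_N : IsClosed (((borelTriple σ J hJ).N : Subgroup ↥(unitaryGroupOfForm σ J)) : Set ↥(unitaryGroupOfForm σ J)) := by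
  haveI : T2Space K := (Literature.NumberTheory.GaloisRepresentations.IsNonarchimedeanLocalField.isLocalField K).toT2Space
  exact (isClosed_upperUnitriangular (n := 3) (R := K)).preimage continuous_subtype_val

omit [(Valued.v : Valuation K ℤᵐ⁰).Compatible] in
/-- `N̄ = w₀ N w₀⁻¹` is closed in `U` (the image of the closed `N` under the homeomorphism `conj w₀`). [cite: Rogawski1990, §1.10 p. 9] -/
theorem isClosed_coe_Nbar :
    IsClosed ((((borelTriple σ J hJ).N).map (MulAut.conj (weylLongU σ hJ)).toMonoidHom : Subgroup ↥(unitaryGroupOfForm σ J)) : Set ↥(unitaryGroupOfForm σ J)) := by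
  rw [Subgroup.coe_map]
  have hφ : ((MulAut.conj (weylLongU σ hJ)).toMonoidHom : ↥(unitaryGroupOfForm σ J) → ↥(unitaryGroupOfForm σ J)) =
      (Homeomorph.mulLeft (weylLongU σ hJ)).trans (Homeomorph.mulRight (weylLongU σ hJ)⁻¹) := by
    funext x; simp
  rw [hφ]
  exact (Homeomorph.isClosed_image _).2 (isClosed_coe_N σ hJ)

omit [(Valued.v : Valuation K ℤᵐ⁰).Compatible] in
include hσc in
/-- **`K₀(y⁻¹) = K₀ ⊓ y⁻¹K₀y` IS COMPACT OPEN** for `K₀ = K_γ ∩ U`, `γ ≠ 0` (★ `isCompact_isOpen_comap_congruenceGL`; the conjugate is the image under the homeomorphism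
`conj y⁻¹`, and a closed subset of the compact `K₀`). [cite: HarishChandra1970, Part VII §8 p. 80] [cite: Casselman1995, Prop. 1.4.4] -/
theorem isCompact_isOpen_conjLevel {γ : ValueGroupWithZero K} (hγ : γ ≠ 0) (y : ↥(unitaryGroupOfForm σ J)) :
    IsCompact (((congruenceGL 3 γ).comap (unitaryGroupOfForm σ J).subtype ⊓
        ((congruenceGL 3 γ).comap (unitaryGroupOfForm σ J).subtype).map (MulAut.conj y⁻¹).toMonoidHom : Subgroup ↥(unitaryGroupOfForm σ J)) :
          Set ↥(unitaryGroupOfForm σ J)) ∧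
      IsOpen (((congruenceGL 3 γ).comap (unitaryGroupOfForm σ J).subtype ⊓
        ((congruenceGL 3 γ).comap (unitaryGroupOfForm σ J).subtype).map (MulAut.conj y⁻¹).toMonoidHom : Subgroup ↥(unitaryGroupOfForm σ J)) :
          Set ↥(unitaryGroupOfForm σ J)) := by
  haveI : T2Space K := (Literature.NumberTheory.GaloisRepresentations.IsNonarchimedeanLocalField.isLocalField K).toT2Space
  obtain ⟨hKc, hKo⟩ := isCompact_isOpen_comap_congruenceGL σ hσc hγ (J := J)
  have hφ : ((MulAut.conj y⁻¹).toMonoidHom : ↥(unitaryGroupOfForm σ J) → ↥(unitaryGroupOfForm σ J)) =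
      (Homeomorph.mulLeft y⁻¹).trans (Homeomorph.mulRight y⁻¹⁻¹) := by
    funext x; simp
  have hKc' : IsCompact ((((congruenceGL 3 γ).comap (unitaryGroupOfForm σ J).subtype).map (MulAut.conj y⁻¹).toMonoidHom : Subgroup ↥(unitaryGroupOfForm σ J)) :
      Set ↥(unitaryGroupOfForm σ J)) := by
    rw [Subgroup.coe_map, hφ]; exact hKc.image (Homeomorph.continuous _)
  have hKo' : IsOpen ((((congruenceGL 3 γ).comap (unitaryGroupOfForm σ J).subtype).map (MulAut.conj y⁻¹).toMonoidHom : Subgroup ↥(unitaryGroupOfForm σ J)) :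
      Set ↥(unitaryGroupOfForm σ J)) := by
    rw [Subgroup.coe_map, hφ]; exact (Homeomorph.isOpen_image _).2 hKo
  rw [Subgroup.coe_inf]
  exact ⟨hKc.inter_right hKc'.isClosed, hKo.inter hKo'⟩

/-! ## §2 THEOREM 20 for `U(σ, Φ₃)(K)` -/

variable [MeasurableSpace ↥(unitaryGroupOfForm σ J)] [BorelSpace ↥(unitaryGroupOfForm σ J)]
  [SecondCountableTopology ↥(unitaryGroupOfForm σ J)] [LocallyCompactSpace ↥(unitaryGroupOfForm σ J)]
  (μ : Measure ↥(unitaryGroupOfForm σ J)) [μ.IsHaarMeasure]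
  (ν : Measure ↥((borelTriple σ J hJ).N)) [SFinite ν] [ν.IsOpenPosMeasure] [IsFiniteMeasureOnCompacts ν] [ν.IsMulLeftInvariant]
  (νbar : Measure ↥(((borelTriple σ J hJ).N).map (MulAut.conj (weylLongU σ hJ)).toMonoidHom))
  [SFinite νbar] [νbar.IsOpenPosMeasure] [IsFiniteMeasureOnCompacts νbar] [νbar.IsMulLeftInvariant]
  {ϖ : K} (hϖ : Valued.v ϖ = WithZero.exp (-1 : ℤ))
  (Ω : ℕ → Set ↥(unitaryGroupOfForm σ J))
  (hmem : ∀ (m : ℕ) (g : ↥(unitaryGroupOfForm σ J)), g ∈ Ω m ↔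
    (∀ i j, Valued.v (ϖ ^ m * ((g : GL (Fin 3) K) : Matrix (Fin 3) (Fin 3) K) i j) ≤ 1) ∧
      ∀ i j, Valued.v (ϖ ^ m * (((g : GL (Fin 3) K)⁻¹ : GL (Fin 3) K) : Matrix (Fin 3) (Fin 3) K) i j) ≤ 1)
  (hinv : ∀ (m : ℕ) (g : ↥(unitaryGroupOfForm σ J)), g ∈ Ω m → g⁻¹ ∈ Ω m)
  (hmul : ∀ (a b : ℕ) (g h : ↥(unitaryGroupOfForm σ J)), g ∈ Ω a → h ∈ Ω b → g * h ∈ Ω (a + b))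

include hσc hσv hϖ hmem hinv hmul in
/-- **THEOREM 20 (HARISH-CHANDRA'S CUSP-FORM CANCELLATION) FOR `U(σ, Φ₃)(K)`.**  Let `K₀ := K_{|ϖ|^m} ∩ U` (`m ≥ 1`), `y ∈ Ω_s`, `K′ := K₀ ⊓ y⁻¹K₀y = K₀(y⁻¹)`, `E` a real
Banach space, `f : U → E` CONTINUOUS with `supp f ⊆ C·T` (`T = torusU`, `C ⊆ Ω_{m_C}`) and CUSPIDAL along `N = unipotentU` and `N̄ = w₀Nw₀` (for left Haar measures
`ν`, `ν̄` on them), `μ` a left Haar measure on `U`.  Then for every `x ∉ Ω_{m_C + (m + 2s + 4m_C) + s}`:  **`∫_{k ∈ K′} f(x y k) dμ(k) = 0`.**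
This is ★ (T20-e1) `cuspForm_cancellation_conjLevel` with `G := U`, `A := T`, `A^± := {diag d : |d₀| ≷ 1}`, `L j := K_{|ϖ|^j}`, all structural hypotheses discharged
from ★ (T20-c), ★ (T20-e2)-discharge FILE 1∕2 and ★ `isCompact_isOpen_comap_congruenceGL`. [cite: HarishChandra1970, Part VII §2 Theorem 20 p. 70; §8 pp. 80–84]
[cite: Casselman1995, Prop. 1.4.3–1.4.4] [cite: Rogawski1990, §1.10 p. 9] -/
theorem cuspForm_cancellation_U3 {m : ℕ} (hm : 1 ≤ m) {s : ℕ} {y : ↥(unitaryGroupOfForm σ J)} (hy : y ∈ Ω s)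
    {E : Type*} [NormedAddCommGroup E] [NormedSpace ℝ E]
    (f : ↥(unitaryGroupOfForm σ J) → E) (hf : Continuous f) (C : Set ↥(unitaryGroupOfForm σ J)) {mC : ℕ} (hC : C ⊆ Ω mC)
    (hsupp : ∀ g, f g ≠ 0 → g ∈ C * (((borelTriple σ J hJ).M : Subgroup ↥(unitaryGroupOfForm σ J)) : Set ↥(unitaryGroupOfForm σ J)))
    (hcusp : ∀ x : ↥(unitaryGroupOfForm σ J), ∫ n : ↥((borelTriple σ J hJ).N), f (x * ↑n) ∂ν = 0)
    (hcuspbar : ∀ x : ↥(unitaryGroupOfForm σ J), ∫ v : ↥(((borelTriple σ J hJ).N).map (MulAut.conj (weylLongU σ hJ)).toMonoidHom), f (x * ↑v) ∂νbar = 0)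
    {x : ↥(unitaryGroupOfForm σ J)} (hx : x ∉ Ω (mC + (m + 2 * s + 4 * mC) + s)) :
    ∫ k in (((congruenceGL 3 (valuation K ϖ ^ m)).comap (unitaryGroupOfForm σ J).subtype ⊓
        ((congruenceGL 3 (valuation K ϖ ^ m)).comap (unitaryGroupOfForm σ J).subtype).map (MulAut.conj y⁻¹).toMonoidHom :
          Subgroup ↥(unitaryGroupOfForm σ J)) : Set ↥(unitaryGroupOfForm σ J)), f (x * y * k) ∂μ = 0 := by
  -- the level `γ = |ϖ|^m`: `0 ≠ γ < 1`, `γ ≤ 1`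
  have hϖv1 : valuation K ϖ < 1 := by
    rw [← v_lt_one_iff_valuation_lt_one, hϖ, ← WithZero.exp_zero, WithZero.exp_lt_exp]; norm_num
  have hϖv0 : valuation K ϖ ≠ 0 :=
    (Valuation.ne_zero_iff _).2 (Literature.NumberTheory.Automorphic.CartanUnique.uniformizer_ne_zero hϖ)
  have hγ1 : valuation K ϖ ^ m < 1 := pow_lt_one₀ zero_le hϖv1 (by omega)
  have hγ0 : valuation K ϖ ^ m ≠ 0 := pow_ne_zero _ hϖv0
  have hγle : valuation K ϖ ^ m ≤ 1 := hγ1.le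
  obtain ⟨hK'c, hK'o⟩ := isCompact_isOpen_conjLevel σ hσc hγ0 y
  have hyΩ := (hmem s y).1 hy
  refine K2E3CuspFormCancellationCore.cuspForm_cancellation_conjLevel μ Ω
    ((congruenceGL 3 (valuation K ϖ ^ m)).comap (unitaryGroupOfForm σ J).subtype) _ (borelTriple σ J hJ).M (borelTriple σ J hJ).N
    (((borelTriple σ J hJ).N).map (MulAut.conj (weylLongU σ hJ)).toMonoidHom) (borelTriple σ J hJ).M
    {a : ↥(unitaryGroupOfForm σ J) | ∃ d : Fin 3 → Kˣ, glDiagonal 3 K d = (a : GL (Fin 3) K) ∧ 1 ≤ Valued.v (d 0 : K)}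
    {a : ↥(unitaryGroupOfForm σ J) | ∃ d : Fin 3 → Kˣ, glDiagonal 3 K d = (a : GL (Fin 3) K) ∧ Valued.v (d 0 : K) ≤ 1}
    (fun j => (congruenceGL 3 (valuation K ϖ ^ j)).comap (unitaryGroupOfForm σ J).subtype) ν νbar
    (fun hg hg' => hmul _ _ _ _ hg hg') (fun hg => hinv _ _ hg)
    (coe_level_subset_heightBall_zero σ Ω hmem _) hy (mem_inf_map_conj_inv_iff σ _ y) (fun u hu => ?_) hK'o hK'c
    (isClosed_coe_N σ hJ) (isClosed_coe_Nbar σ hJ) f hf C hC hsupp hcusp hcuspbar (torusU_mem_plus_or_minus σ hJ)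
    (fun k hk => ?_) (fun k hk => ?_)
    (fun a ha t ht => conj_mem_level_of_mem_torusU σ hJ _ ha ht)
    (fun a ha n hn => conj_mem_N_of_mem_torusU σ hJ ha hn) (fun a ha v hv => conj_mem_Nbar_of_mem_torusU σ hJ ha hv)
    (mem_heightBall_two_mul_of_mul_mem_N σ hσv hJ hϖ Ω hmem hinv hmul) (mem_heightBall_two_mul_of_mul_mem_Nbar σ hσv hJ hϖ Ω hmem hinv hmul)
    (conj_mem_level_of_plus_of_mem_Nbar σ hσv hJ hγle) (inv_conj_mem_level_of_plus_of_mem_N σ hσv hJ hϖ Ω hmem hinv)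
    (conj_mem_level_of_minus_of_mem_N σ hσv hJ hγle) (inv_conj_mem_level_of_minus_of_mem_Nbar σ hσv hJ hϖ Ω hmem hinv) hx
  · -- `hdeep`: the deep level `K_{|ϖ|^{m+2s}}` lies in `K₀ ∩ y⁻¹K₀y` (★ (T20-c) §3)
    exact ⟨(Subgroup.mem_inf.1 (K2E3IwahoriFactorisedLevelU3.comap_congruenceGL_le_inf_map_conj_of_heightBall σ hϖ m s hyΩ hu)).1,
      (K2E3IwahoriFactorisedLevelU3.conj_mem_comap_congruenceGL_of_heightBall σ hϖ m s hyΩ hu).1⟩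
  · -- `hIw`: the `N̄ · T · N` Iwahori order (★ `coe_comap_congruenceGL_eq_mul` via ★ (T20-c))
    obtain ⟨⟨nb, t, n, hnb, ht, hn, h⟩, -⟩ := K2E3IwahoriFactorisedLevelU3.exists_iwahori_factorisations_of_mem_comap_congruenceGL σ hJ hγ1 hk
    exact ⟨nb, hnb, t, ht, n, hn, h⟩
  · -- `hIw'`: the `N · T · N̄` order (★ (T20-c) `coe_comap_congruenceGL_eq_mul_rev`)
    obtain ⟨-, ⟨n, t, nb, hn, ht, hnb, h⟩⟩ := K2E3IwahoriFactorisedLevelU3.exists_iwahori_factorisations_of_mem_comap_congruenceGL σ hJ hγ1 hk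
    exact ⟨n, hn, t, ht, nb, hnb, h⟩

end Model

end Summit.HodgeConjecture.HodgeConjecture.Cruxes.H413.K2E3CuspFormCancellationU3

end
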